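import Summits.CriticalPhenomena.Ising3DConformalLimit.Theorems.LeeYangGapNearCriticalLeeYangGapWeightedBinder
import Summits.CriticalPhenomena.Ising3DConformalLimit.Theorems.LeeYangGapNearCriticalLeeYangGapOfOneArmHyperscaling
import Summits.CriticalPhenomena.Ising3DConformalLimit.Theorems.LeeYangGapFirstZeroAntitoneInBeta
import Summits.CriticalPhenomena.Ising3DConformalLimit.Theorems.LeeYangGapMonotonicityTransfer
import Summits.CriticalPhenomena.Ising3DConformalLimit.Theorems.LeeYangGapNewmanFirstZeroBound
import Literature.Probability.LatticeModels.GaussianPairingBound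

/-!
# A block Binder cumulant floor along a subsequence makes the critical smeared field non-Gaussian

For the nearest-neighbour Ising model on `ℤ^d`, `d ≥ 3`, in the critical plus state: if the block
Binder cumulant `g_L = (3⟨M_L²⟩² - ⟨M_L⁴⟩)/⟨M_L²⟩²` (`M_L = ∑_{x ∈ Λ_L} σ_x`) satisfies `g_L ≥ c > 0`
for infinitely many `L`, then `Literature.Barriers.CriticalPhenomena.HasNonGaussianCriticalSmearing d`
holds (`hasNonGaussianCriticalSmearing_of_binder_frequently`): the tent test function
`f = ∏ᵢ max(0, min(1, 2 - |vᵢ|))` at `z = 1` has `⟨exp[T_{f,L} - ⟨T_{f,L}²⟩/2]⟩_{β_c} ≤ 1 - δ`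
at those `L`. Ingredients (`…WeightedBinder`): Lebowitz monotonicity of the Binder numerator in the
weights, so `⟨T⁴⟩ ≤ 3⟨T²⟩² - c`; Newman's Gaussian domination of the even moments
(`PairingLowerBound`, a tree theorem) and the moment series; the variance bound
`integral_normalizedField_sq_le`. This is the `U₄` criterion of Aizenman, CDM 2020, §7
(Prop. 7.1–7.2, Cor. 7.3) in the direction "`limsup g_L > 0` ⟹ non-Gaussian", for the smeared
field of Aizenman–Duminil-Copin 2021, §1.2 / Prop. 1.4.

On `ℤ³`: crux stmt-CriticalPhenomena-4945 `NearCriticalLeeYangGap` implies the survey target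
(`hasNonGaussianCriticalSmearing_three_of_nearCriticalLeeYangGap`, through the proved supports
4947/4948/4949), and so does ONE-ARM HYPERSCALING, item stmt-CriticalPhenomena-15591
(`hasNonGaussianCriticalSmearing_three_of_oneArmHyperscaling`, through
`nearCriticalLeeYangGap_of_oneArmHyperscaling`).
-/

noncomputable section

namespace Summit.CriticalPhenomena.Ising3DConformalLimit.LeeYangGapSmearedNonGaussianity

open MeasureTheory Filter Topology Finset
open scoped Nat BigOperators
open Literature.Probability.LatticeModels Literature.Probability.Percolation
open Literature.Barriers.CriticalPhenomena

variable {d : ℕ}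

/-! ### 4. One scale, and the subsequence statement -/

/-- **One scale.** Let `μ` carry the plus correlations at `β_c` (`d ≥ 3`), satisfy Newman's Gaussian
domination and have vanishing odd correlations; let `0 ≤ f` vanish outside `[-2,2]^d` and equal `1`
on `[-1,1]^d`. If at scale `L ≥ 1` the block Binder numerator satisfies `c Σ_L² ≤ 3Σ_L² - ⟨M_L⁴⟩`,
then `⟨exp[z T_{f,L} - z²⟨T_{f,L}²⟩/2]⟩_{β_c} ≤ 1 - (c z⁴/24) exp(-z²⟨T_{f,L}²⟩/2)`.
[cite: AizenmanCDM2020, §7 Prop. 7.1–7.2] -/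
theorem criticalSmearedMGF_le_of_binder (hd : 3 ≤ d)
    {μ : Measure (SpinConfig (Site d))} [IsProbabilityMeasure μ]
    (hμ : ∀ A : Finset (Site d), spinCorr μ A = plusCorr d (criticalBeta d) 0 A)
    (hlow : PairingLowerBound μ)
    (hodd : ∀ {n : ℕ}, Odd n → ∀ x : Fin n → Site d, ∫ σ, ∏ i, spinAt (x i) σ ∂μ = 0)
    {f : EuclideanSpace ℝ (Fin d) → ℝ} (hf0 : ∀ v, 0 ≤ f v)
    (hfr : ∀ v, f v ≠ 0 → ∀ i, |v i| ≤ 2) (hf1 : ∀ v, (∀ i, |v i| ≤ 1) → f v = 1)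
    {L : ℕ} (hL : 1 ≤ L) {c : ℝ}
    (hcL : c * (plusExpect d (criticalBeta d) 0 (fun σ => (∑ x ∈ box d L, spinAt x σ) ^ 2)) ^ 2 ≤
      3 * (plusExpect d (criticalBeta d) 0 (fun σ => (∑ x ∈ box d L, spinAt x σ) ^ 2)) ^ 2 -
        plusExpect d (criticalBeta d) 0 (fun σ => (∑ x ∈ box d L, spinAt x σ) ^ 4))
    (z : ℝ) :
    criticalSmearedMGF d f L z ≤
      1 - c * z ^ 4 / 24 * Real.exp (-(z ^ 2 / 2 * ∫ σ, normalizedField μ L f σ ^ 2 ∂μ)) := by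
  have hβ := Literature.Probability.LatticeModels.criticalBeta_nonneg d
  have hLpos : (0 : ℝ) < (L : ℝ) := Nat.cast_pos.mpr (by omega)
  have hLne : ((L : ℕ) : ℝ) ≠ 0 := hLpos.ne'
  -- Gaussian domination and vanishing odd moments of `T = T_{f,L}`
  have hdomT : ∀ n : ℕ, ∫ σ, normalizedField μ L f σ ^ (2 * n) ∂μ ≤
      ((2 * n)! : ℝ) / (2 ^ n * n !) * (∫ σ, normalizedField μ L f σ ^ 2 ∂μ) ^ n := fun n =>
    integral_normalizedField_pow_le_of_pairingLowerBound hlow hLpos (hasCompactSupport_of_cube hfr)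
      hf0 n
  have hoddT : ∀ n : ℕ, ∫ σ, normalizedField μ L f σ ^ (2 * n + 1) ∂μ = 0 := fun n => by
    rw [integral_normalizedField_pow μ hLne hfr (2 * n + 1)]
    refine mul_eq_zero_of_right _ (Finset.sum_eq_zero fun p _ => ?_)
    rw [hodd ⟨n, rfl⟩ p, mul_zero]
  -- `T = s₀ · S`, `S = ∑_{x ∈ Λ_{2L}} f(x/L) σ_x`, `s₀ = Σ_L^{-1/2}`
  set s₀ : ℝ := (Real.sqrt (blockSpinVariance μ L))⁻¹ with hs₀
  set Bx : Finset (Site d) := latticeBox d (2 / |((L : ℕ) : ℝ)⁻¹|) with hBx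
  set w : Site d → ℝ := fun x => f (((L : ℕ) : ℝ)⁻¹ • siteVec x) with hw
  have hTS : ∀ σ, normalizedField μ L f σ = s₀ * ∑ x ∈ Bx, w x * spinAt x σ := fun σ =>
    normalizedField_eq_mul_sum μ hLne hfr σ
  have hT2 : ∫ σ, normalizedField μ L f σ ^ 2 ∂μ = s₀ ^ 2 * ∫ σ, (∑ x ∈ Bx, w x * spinAt x σ) ^ 2 ∂μ := by
    simp_rw [hTS, mul_pow]; rw [integral_const_mul]
  have hT4 : ∫ σ, normalizedField μ L f σ ^ 4 ∂μ = s₀ ^ 4 * ∫ σ, (∑ x ∈ Bx, w x * spinAt x σ) ^ 4 ∂μ := by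
    simp_rw [hTS, mul_pow]; rw [integral_const_mul]
  -- `Σ_L` and `⟨M_L⁴⟩` as integrals
  have hSig : plusExpect d (criticalBeta d) 0 (fun σ => (∑ x ∈ box d L, spinAt x σ) ^ 2) =
      blockSpinVariance μ L := blockVariance_eq_blockSpinVariance hβ hμ L
  have hSigpos : 0 < blockSpinVariance μ L := hSig ▸ blockVariance_pos hβ L
  have hbox : latticeBox d ((L : ℕ) : ℝ) = box d L := by
    rw [latticeBox_eq_box (Nat.cast_nonneg L), Nat.floor_natCast]
  have hSigint : blockSpinVariance μ L = ∫ σ, (∑ x ∈ box d L, spinAt x σ) ^ 2 ∂μ := by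
    rw [blockSpinVariance, hbox]
  have hM4 : plusExpect d (criticalBeta d) 0 (fun σ => (∑ x ∈ box d L, spinAt x σ) ^ 4) =
      ∫ σ, (∑ x ∈ box d L, spinAt x σ) ^ 4 ∂μ :=
    plusExpect_spinFun_eq_integral hβ le_rfl hμ (box d L) (fun s => (∑ x ∈ box d L, s x) ^ 4)
      fun s t hst => by rw [Finset.sum_congr rfl hst]
  -- Lebowitz monotonicity: the weights `w` are `1` on `Λ_L ⊆ Λ_{2L}` and in `[0, 1]`
  have hsub : box d L ⊆ Bx := by
    intro x hx
    rw [hBx, mem_latticeBox]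
    intro i
    obtain ⟨h₁, h₂⟩ := (mem_box.mp hx) i
    have hxi : |((x i : ℤ) : ℝ)| ≤ L := abs_le.mpr ⟨by exact_mod_cast h₁, by exact_mod_cast h₂⟩
    rw [abs_inv, abs_of_pos hLpos, div_inv_eq_mul]
    linarith
  have hw1 : ∀ x ∈ box d L, w x = 1 := by
    intro x hx
    refine hf1 _ fun i => ?_
    obtain ⟨h₁, h₂⟩ := (mem_box.mp hx) i
    have hxi : |((x i : ℤ) : ℝ)| ≤ L := abs_le.mpr ⟨by exact_mod_cast h₁, by exact_mod_cast h₂⟩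
    rw [PiLp.smul_apply, smul_eq_mul, siteVec_apply, abs_mul, abs_inv, abs_of_pos hLpos,
      inv_mul_le_iff₀ hLpos, mul_one]
    exact hxi
  have hmono := binderNumerator_mono hd hμ hsub (w := w) (fun x => hf0 _) hw1
  -- assemble
  have hcS : c * blockSpinVariance μ L ^ 2 ≤
      3 * (∫ σ, (∑ x ∈ Bx, w x * spinAt x σ) ^ 2 ∂μ) ^ 2 -
        ∫ σ, (∑ x ∈ Bx, w x * spinAt x σ) ^ 4 ∂μ := by
    rw [hSig, hM4] at hcL
    rw [hSigint] at hcL ⊢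
    exact hcL.trans hmono
  have hs2 : s₀ ^ 2 * blockSpinVariance μ L = 1 := by
    rw [hs₀, inv_pow, Real.sq_sqrt hSigpos.le, inv_mul_cancel₀ hSigpos.ne']
  have h4 : ∫ σ, normalizedField μ L f σ ^ 4 ∂μ ≤
      3 * (∫ σ, normalizedField μ L f σ ^ 2 ∂μ) ^ 2 - c := by
    have hs4 : 0 ≤ s₀ ^ 4 := by positivity
    calc ∫ σ, normalizedField μ L f σ ^ 4 ∂μ
        = s₀ ^ 4 * ∫ σ, (∑ x ∈ Bx, w x * spinAt x σ) ^ 4 ∂μ := hT4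
      _ ≤ s₀ ^ 4 * (3 * (∫ σ, (∑ x ∈ Bx, w x * spinAt x σ) ^ 2 ∂μ) ^ 2 -
            c * blockSpinVariance μ L ^ 2) := mul_le_mul_of_nonneg_left (by linarith) hs4
      _ = 3 * (s₀ ^ 2 * ∫ σ, (∑ x ∈ Bx, w x * spinAt x σ) ^ 2 ∂μ) ^ 2 -
            c * (s₀ ^ 2 * blockSpinVariance μ L) ^ 2 := by ring
      _ = 3 * (∫ σ, normalizedField μ L f σ ^ 2 ∂μ) ^ 2 - c := by rw [← hT2, hs2]; ring
  have hexp := integral_exp_le_of_gaussian_domination (measurable_normalizedField μ hLne hfr)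
    (abs_normalizedField_le μ hLne hfr) hdomT h4 hoddT z
  rw [criticalSmearedMGF_eq hμ hfr hL z]
  set Vf : ℝ := ∫ σ, normalizedField μ L f σ ^ 2 ∂μ
  have hpos : 0 < Real.exp (-(z ^ 2 / 2 * Vf)) := Real.exp_pos _
  calc Real.exp (-(z ^ 2 / 2 * Vf)) * ∫ σ, Real.exp (z * normalizedField μ L f σ) ∂μ
      ≤ Real.exp (-(z ^ 2 / 2 * Vf)) * (Real.exp (z ^ 2 / 2 * Vf) - c * z ^ 4 / 24) :=
        mul_le_mul_of_nonneg_left hexp hpos.le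
    _ = 1 - c * z ^ 4 / 24 * Real.exp (-(z ^ 2 / 2 * Vf)) := by
        rw [mul_sub, ← Real.exp_add, neg_add_cancel, Real.exp_zero]; ring

/-- **A Binder floor along a subsequence gives a non-Gaussian smeared critical field** (`d ≥ 3`):
if `c ⟨M_L²⟩² ≤ 3⟨M_L²⟩² - ⟨M_L⁴⟩` in the critical plus state for some `c > 0` and infinitely many
`L`, then `HasNonGaussianCriticalSmearing d` — witnessed by the tent test function at `z = 1`
(Aizenman, CDM 2020, §7: the `U₄` criterion, direction "`limsup g_L > 0` ⟹ non-Gaussian").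
[cite: AizenmanCDM2020, §7 Prop. 7.1–7.2 and Cor. 7.3] [cite: AizenmanDuminilCopinAnnals2021, Prop. 1.4] -/
theorem hasNonGaussianCriticalSmearing_of_binder_frequently (hd : 3 ≤ d) {c : ℝ} (hc : 0 < c)
    (hfreq : ∃ᶠ L : ℕ in atTop,
      c * (plusExpect d (criticalBeta d) 0 (fun σ => (∑ x ∈ box d L, spinAt x σ) ^ 2)) ^ 2 ≤
        3 * (plusExpect d (criticalBeta d) 0 (fun σ => (∑ x ∈ box d L, spinAt x σ) ^ 2)) ^ 2 -
          plusExpect d (criticalBeta d) 0 (fun σ => (∑ x ∈ box d L, spinAt x σ) ^ 4)) :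
    HasNonGaussianCriticalSmearing d := by
  obtain ⟨f, hf, hf0, -, hfr, hf1⟩ := exists_tent_testFunction d
  have hβ := Literature.Probability.LatticeModels.criticalBeta_nonneg d
  have hm' : spontaneousMagnetization d (criticalBeta d) = 0 :=
    spontaneousMagnetization_criticalBeta_eq_zero_holds (d := d) hd
  obtain ⟨μ, hμG, hTI, hcorr⟩ := exists_freeMeasure_holds d (β := criticalBeta d) 0 hβ le_rfl
  haveI : IsProbabilityMeasure μ := hμG.1
  have hμ : ∀ A, spinCorr μ A = plusCorr d (criticalBeta d) 0 A := fun A =>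
    (hcorr A).trans (freeCorr_eq_plusCorr_of_spontaneousMagnetization_eq_zero hβ hm' A)
  have hodd : ∀ {n : ℕ}, Odd n → ∀ x : Fin n → Site d, ∫ σ, ∏ i, spinAt (x i) σ ∂μ = 0 :=
    fun hn x => integral_prod_spinAt_eq_zero_of_freeCorr hβ hcorr hn x
  have hlow : PairingLowerBound μ :=
    pairingLowerBound_of_finite aizenman_nPoint_le_pairingSum_finite_holds hβ hcorr
  -- Griffiths' first inequality: non-negative pair correlations
  have hG : ∀ x y, 0 ≤ ∫ σ, spinAt x σ * spinAt y σ ∂μ := by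
    classical
    intro x y
    by_cases hxy : x = y
    · subst hxy
      simp
    · have hpair : ∀ σ, spinAt x σ * spinAt y σ = spinProduct {x, y} σ := fun σ => by
        rw [spinProduct, Finset.prod_pair hxy]
      simp_rw [hpair]
      change 0 ≤ spinCorr μ {x, y}
      rw [hμ]
      exact plusCorr_nonneg hβ le_rfl _
  set Cv : ℝ := (⨆ x, |f x|) ^ 2 * ((((2 * (⌈(2 : ℝ)⌉₊ + 1) + 1) ^ d : ℕ) : ℝ) ^ 2) with hCv
  have hvar : ∀ L : ℕ, 1 ≤ L → ∫ σ, normalizedField μ L f σ ^ 2 ∂μ ≤ Cv := fun L hL =>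
    integral_normalizedField_sq_le μ hTI hG hf (by norm_num) hfr (Nat.one_le_cast.mpr hL)
  refine ⟨f, hf, hasCompactSupport_of_cube hfr, 1, one_pos, fun hT => ?_⟩
  set δ : ℝ := c / 24 * Real.exp (-(Cv / 2)) with hδ
  have hδpos : 0 < δ := by positivity
  have hkey : ∃ᶠ L : ℕ in atTop, criticalSmearedMGF d f L 1 ≤ 1 - δ := by
    refine (hfreq.and_eventually (eventually_ge_atTop 1)).mono fun L hL => ?_
    obtain ⟨hcL, hL1⟩ := hL
    have h := criticalSmearedMGF_le_of_binder hd hμ hlow hodd hf0 hfr hf1 hL1 hcL 1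
    have hexp : Real.exp (-(Cv / 2)) ≤
        Real.exp (-((1 : ℝ) ^ 2 / 2 * ∫ σ, normalizedField μ L f σ ^ 2 ∂μ)) :=
      Real.exp_le_exp.mpr (by linarith [hvar L hL1])
    calc criticalSmearedMGF d f L 1
        ≤ 1 - c * (1 : ℝ) ^ 4 / 24 *
            Real.exp (-((1 : ℝ) ^ 2 / 2 * ∫ σ, normalizedField μ L f σ ^ 2 ∂μ)) := h
      _ ≤ 1 - δ := by
          rw [hδ]
          nlinarith [hexp, hc.le]
  have hev : ∀ᶠ L : ℕ in atTop, 1 - δ < criticalSmearedMGF d f L 1 :=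
    hT.eventually (lt_mem_nhds (by linarith))
  obtain ⟨L, h1, h2⟩ := (hkey.and_eventually hev).exists
  exact absurd h1 (not_le.mpr h2)

/-! ### 5. `ℤ³`: crux 4945 and one-arm hyperscaling imply the survey target -/

/-- **GAP ⟹ a Binder floor frequently** (the route's assembly argument, items 4947–4949 PROVED):
a near-critical Lee–Yang zero `θ` at the fluctuation scale (`θ²Σ_L ≤ C`) is moved to `β_c`
(`MonotonicityTransfer ∘ FirstZeroAntitoneInBeta`) and fed to Newman's bound `12/θ⁴ ≤ 3Σ_L² - ⟨M_L⁴⟩`,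
giving `(12/C²)·Σ_L² ≤ 3Σ_L² - ⟨M_L⁴⟩` for infinitely many `L`. [cite: Newman1975, Thm 3] -/
theorem binder_frequently_of_nearCriticalLeeYangGap
    (hGap : Summit.CriticalPhenomena.Ising3DConformalLimit.Theses.LeeYangGap.NearCriticalLeeYangGap) :
    ∃ c : ℝ, 0 < c ∧ ∃ᶠ L : ℕ in atTop,
      c * (plusExpect 3 (criticalBeta 3) 0 (fun σ => (∑ x ∈ box 3 L, spinAt x σ) ^ 2)) ^ 2 ≤
        3 * (plusExpect 3 (criticalBeta 3) 0 (fun σ => (∑ x ∈ box 3 L, spinAt x σ) ^ 2)) ^ 2 -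
          plusExpect 3 (criticalBeta 3) 0 (fun σ => (∑ x ∈ box 3 L, spinAt x σ) ^ 4) := by
  set V : ℕ → ℝ := fun L => plusExpect 3 (criticalBeta 3) 0
    (fun σ => (∑ x ∈ box 3 L, spinAt x σ) ^ 2) with hV
  set M4 : ℕ → ℝ := fun L => plusExpect 3 (criticalBeta 3) 0
    (fun σ => (∑ x ∈ box 3 L, spinAt x σ) ^ 4) with hM4
  have hβc : (0 : ℝ) ≤ criticalBeta 3 := Literature.Probability.LatticeModels.criticalBeta_nonneg 3
  have hVpos : ∀ L, 0 < V L := fun L => blockVariance_pos (d := 3) hβc L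
  obtain ⟨C, hC⟩ := hGap
  have hfreq : ∃ᶠ L : ℕ in atTop, 0 < C ∧ 12 / C ^ 2 * (V L) ^ 2 ≤ 3 * (V L) ^ 2 - M4 L := by
    refine hC.mono fun L hL => ?_
    obtain ⟨β, θ, hβ0, hβc', hθ, hθC, hzero⟩ := hL
    obtain ⟨θ', hθ', hθ'θ, hzero'⟩ := Theorems.monotonicityTransfer_proof
      Theorems.firstZeroAntitoneInBeta_proof L β (criticalBeta 3) θ hβ0 hβc' le_rfl hθ hzero
    have hN : 12 / θ' ^ 4 ≤ 3 * (V L) ^ 2 - M4 L :=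
      LeeYangGapNewmanFirstZeroBound.newmanFirstZeroBound_proof L θ' hθ' hzero'
    have hVL : 0 < V L := hVpos L
    have hθ'C : θ' ^ 2 * V L ≤ C :=
      (mul_le_mul_of_nonneg_right (pow_le_pow_left₀ hθ'.le hθ'θ 2) hVL.le).trans hθC
    have hprod : 0 < θ' ^ 2 * V L := mul_pos (pow_pos hθ' 2) hVL
    have hCpos : 0 < C := lt_of_lt_of_le hprod hθ'C
    refine ⟨hCpos, ?_⟩
    have hsq : (θ' ^ 2 * V L) ^ 2 ≤ C ^ 2 := pow_le_pow_left₀ hprod.le hθ'C 2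
    calc 12 / C ^ 2 * (V L) ^ 2 ≤ 12 / (θ' ^ 2 * V L) ^ 2 * (V L) ^ 2 :=
          mul_le_mul_of_nonneg_right
            (div_le_div_of_nonneg_left (by norm_num) (pow_pos hprod 2) hsq) (sq_nonneg _)
      _ = 12 / θ' ^ 4 := by
          field_simp
      _ ≤ 3 * (V L) ^ 2 - M4 L := hN
  obtain ⟨L₀, hCpos, -⟩ := hfreq.exists
  exact ⟨12 / C ^ 2, by positivity, hfreq.mono fun L hL => hL.2⟩

/-- **Crux 4945 ⟹ the survey target I-1**: `NearCriticalLeeYangGap → HasNonGaussianCriticalSmearing 3`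
(the smeared non-Gaussianity of Aizenman–Duminil-Copin 2021, Prop. 1.4, negated at `d = 3`).
[cite: AizenmanDuminilCopinAnnals2021, Prop. 1.4] [cite: AizenmanCDM2020, §7 Cor. 7.3] -/
theorem hasNonGaussianCriticalSmearing_three_of_nearCriticalLeeYangGap
    (hGap : Summit.CriticalPhenomena.Ising3DConformalLimit.Theses.LeeYangGap.NearCriticalLeeYangGap) :
    HasNonGaussianCriticalSmearing 3 := by
  obtain ⟨c, hc, hfreq⟩ := binder_frequently_of_nearCriticalLeeYangGap hGap
  exact hasNonGaussianCriticalSmearing_of_binder_frequently (by norm_num) hc hfreq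

/-- **ONE-ARM HYPERSCALING ⟹ the survey target I-1**, unconditionally: item stmt-CriticalPhenomena-15591
`(⟨σ₀⟩⁺_{Λ_{Kn},β_c})² ≤ C⟨σ₀σ_{2ne₁}⟩_{β_c}` implies `HasNonGaussianCriticalSmearing 3` (through
`nearCriticalLeeYangGap_of_oneArmHyperscaling`). [cite: AizenmanDuminilCopinAnnals2021, Prop. 1.4] -/
theorem hasNonGaussianCriticalSmearing_three_of_oneArmHyperscaling
    (hOA : Summit.CriticalPhenomena.Ising3DConformalLimit.Theses.ArmHyperscaling.OneArmHyperscaling) :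
    HasNonGaussianCriticalSmearing 3 :=
  hasNonGaussianCriticalSmearing_three_of_nearCriticalLeeYangGap
    (LeeYangGapNearCriticalLeeYangGap.nearCriticalLeeYangGap_of_oneArmHyperscaling hOA)

end Summit.CriticalPhenomena.Ising3DConformalLimit.LeeYangGapSmearedNonGaussianity

end
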